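import Summits.QuantumFields.BalabanUV.T4Continuum.Support.VariationalColourTaxiTower
import Summits.QuantumFields.BalabanUV.T4Continuum.Support.VariationalTaxiTowerFlux

/-!
# T⁴ programme, spine node NE2 (U1a), lane P2 — «WILSON-LINE TOWERS», file 1: THE LATTICE WILSON-LINE APPROXIMANTS OF A LIPSCHITZ CONTINUUM
# U(1) CONNECTION — coordinates, Wilson-line phases, the bounds (size, own-direction Lipschitz, plaquette commutator) and EXACT COHERENCE
# under straight `L`-bond coarsening (model level; cell `pub-balaban`)

NE2 formalisation swarm `b2b-balaban-t4-ne2-formalise-*`, leaf prover 04 GEN 8 (`prover-b2b-balaban-t4-ne2-formalise-leaf-04-g8-0`); register row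
«P2-sup» of `t4/formal/NE2/LEAVES.md`; journal CLAIMS.log INTENT «WILSON-LINE TOWERS» 2026-08-20 l.23684.

WHY.  The vector END of road P2 at Bałaban's taxi data (this lineage's parts 1–9 and gen 7's bridge files, leaf-10's hosts) is a theorem about a
COHERENT tower of UNITARY one-step bond operators in the scale-invariant plaquette class `(L^{k+1})²·b_k ≤ c`, presented in a REGULAR gauge
(`‖R^{(k)} − 1‖ ≤ ar_k`, `L^k·ar_k ≤ α`; own-direction lattice-Lipschitz `‖R^{(k)}(x,μ) − R^{(k)}(x−e_μ,μ)‖ ≤ ℓr_k`, `(L^k)²·ℓr_k ≤ λ`).  Which data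
inhabit ALL of these at once, beyond the flat field?  NOT this lineage's constant-flux towers (gen 3, `VariationalTaxiTowerFluxTower`): their
Polyakov loops vary over the whole circle, so in every gauge some bond column is `O(1)` away from `1` — the regular class excludes the
topological sectors (remark; nothing about it is claimed below).  THIS FILE: the lattice approximants of ANY bounded, coordinate-Lipschitz,
periodic continuum connection `A` on the torus `Π_ν ℝ∕M_ν` do — level by level the bond variable is the WILSON LINE `exp(i∫_bond A)`.

THE OBJECTS ([folklore], OURS).  `A : (Fin d → ℝ) → Fin d → ℝ` (component `μ` at the point `p`); hypotheses used below, each where needed: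
`|A p μ| ≤ α₀` (size), `|A (p + h·e_ν) μ − A p μ| ≤ lip·|h|` (Lipschitz along the coordinate directions), `A (p + M_ν·e_ν) = A p` (periodic),
`Continuous A` (for the interval integrals).
 * `ev ν` — the coordinate vector `e_ν` of `ℝ^d`; `pt n x` — the continuum point `(val x_ν ∕ n)_ν` of a site `x : Tor N` at spacing `n⁻¹`;
 * `wl n A x μ := ∫₀^{n⁻¹} A (pt n x + s·e_μ) μ ds` — the WILSON-LINE PHASE of the bond `(x, μ)` at spacing `n⁻¹` (arc-length parametrised);
 * `wlR n A x μ := exp (i·wl n A x μ)` — the U(1) bond variable.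
THE THEOREMS.
 * §1 coordinates: `pt_corner_add_tstep` (the `s`-th site on the straight coarse bond from the block corner sits at `pt n y + (s∕(nL))·e_μ`),
   `pt_sites`, and — with `N_ν = n·M_ν` and `A` periodic — `A_pt_add_unitVec` ∕ `A_pt_sub_unitVec` (one lattice step moves the argument of `A` by
   `± n⁻¹·e_ν`, the wrap-around absorbed by periodicity);
 * §2 `norm_wlR` (unit modulus), `abs_wl_le` (`|wl| ≤ α₀∕n`), **`norm_wlR_sub_one_le`** (`‖wlR − 1‖ ≤ α₀∕n` — the size line of the regular
   presentation), `norm_wlR_sub_wlR_le` ∕ `norm_wlR_mul_sub_mul_le` (`‖e^{ia} − e^{ib}‖ ≤ |a − b|` for bond variables and their products);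
 * §3 `abs_lineIntegral_shift_sub_le` (shifting the base point by `h·e_ν` moves the line integral by `≤ lip·|h|∕n`), **`abs_wl_add_unitVec_sub_le`**
   (moving the bond by one lattice step in ANY direction changes the phase by `≤ lip∕n²`), hence **`norm_wlR_sub_wlR_back_le`** (own-direction
   Lipschitz `≤ lip∕n²`) and **`norm_wlR_comm_le`** (the END's plaquette commutator `‖R(x,κ)R(x+e_κ,ι) − R(x,ι)R(x+e_ι,κ)‖ ≤ 2lip∕n²` —
   Lipschitz across ONE lattice spacing, no Stokes);
 * §4 EXACT COHERENCE: **`coarseT_wlR`** (`coarseT L (fine n M) (wlR (n·L) A) = wlR n A`: the straight product of the `L` sub-bond Wilson lines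
   IS the Wilson line of the coarse bond — additivity of the line integral, `Complex.exp_sum`) and `Rtr_wlR` (reading through `sites` preserves
   coordinates).
File 2 (`WilsonLineTowerData`) lifts these to the operator tower `phase ∘ wlR (L^k·L) A` and reads off EVERY data hypothesis of the vector END;
file 3 (`WilsonLineTowerEnd`) instantiates the ENDs of record.

HONEST FRAMING (T4-DAG p. 1).  Elementary calculus on OUR model objects (U(1), `E = ℂ`; c5: nothing here is Bałaban's `U_k`); nothing printed is
a hypothesis; data `def`s `ev`∕`pt`∕`wl`∕`wlR` only, no `def … : Prop`, no `sorry`; axioms standard.  By itself this file proves NO END; V-END with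
background ∕ NE2 NOT proved; NE3 OPEN; spine PROVED 0∕9 unchanged; rung (B)+1 on a fixed finite T⁴ — NOT infinite volume, NOT mass gap, NOT Clay.
HONEST DEPENDENCY (cell, verbatim): continuum YM on T⁴ ⇐ BetaPertH ∧ nine spine estimates (0/9 proved); BetaPertH ⇐ (D1) ∧ (D4) ∧ CAP+tail;
G-an2-4 gates asym, D1 and NE2/3/4.
-/

noncomputable section

open scoped BigOperators
open Finset MeasureTheory intervalIntegral

namespace Summit.QuantumFields.BalabanUV.T4Continuum.WilsonLineTower

open Literature.MathematicalPhysics.QuantumFieldTheory.Balaban1983to89.B5Prop11Plancherel (Tor fine unitVec)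
open Literature.MathematicalPhysics.QuantumFieldTheory.Balaban1983to89.B5Block118 (tstep bpt)
open Literature.MathematicalPhysics.QuantumFieldTheory.Balaban1983to89.B5Composition116 (sites)
open Summit.QuantumFields.BalabanUV.T4Continuum.VariationalCovariantFederbush (piT)
open Summit.QuantumFields.BalabanUV.T4Continuum.VariationalCovariantTower (Rtr)
open Summit.QuantumFields.BalabanUV.T4Continuum.VariationalTaxiCoarse (coarseT)
open Summit.QuantumFields.BalabanUV.T4Continuum.VariationalTaxiTowerFlux (val_corner_add_tstep val_sites piT_eq_prod add_unitVec_self add_unitVec_ne)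

variable {d : ℕ}

/-! ## §1 Continuum coordinates of lattice sites -/

section Coordinates

/-- the coordinate vector `e_ν` of `ℝ^d`. [folklore] -/
def ev (ν : Fin d) : Fin d → ℝ := fun ι => if ι = ν then 1 else 0

/-- the continuum point of the lattice site `x` at spacing `n⁻¹`: coordinates `val x_ν ∕ n`. [folklore] -/
def pt (n : ℕ) {N : Fin d → ℕ} (x : Tor N) : Fin d → ℝ := fun ν => ((x ν).val : ℝ) / n

/-- `e_ν` has `ν`-coordinate `1` … [folklore] -/
@[simp] theorem ev_apply_self (ν : Fin d) : ev ν ν = 1 := by simp [ev]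

/-- … and the other coordinates `0`. [folklore] -/
theorem ev_apply_ne {ν ι : Fin d} (h : ι ≠ ν) : ev ν ι = 0 := by simp [ev, h]

/-- `val (z + 1)` on `ZMod m`: wraps to `0` exactly on the last residue (any `m ≥ 1`). [folklore] -/
theorem val_add_one' {m : ℕ} [NeZero m] (z : ZMod m) : (z + 1).val = if z.val + 1 = m then 0 else z.val + 1 := by
  rcases Nat.lt_or_ge m 2 with hm | hm
  · have hm1 : m = 1 := by have := NeZero.ne m; omega
    subst hm1
    have hz : z.val = 0 := by have := z.val_lt; omega
    simp [hz, ZMod.val_add, Nat.mod_one]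
  · exact VariationalTaxiTowerFlux.val_add_one hm z

variable (n : ℕ) {N : Fin d → ℕ} [hN : ∀ ν, NeZero (N ν)]

omit hN in
/-- coordinates of `pt`. [folklore] -/
theorem pt_apply (x : Tor N) (ν : Fin d) : pt n x ν = ((x ν).val : ℝ) / n := rfl

/-- ONE LATTICE STEP FORWARD: `pt n (x + e_ν) = pt n x + n⁻¹·e_ν`, minus the period `M_ν·e_ν` on the wrap-around (`N_ν = n·M_ν`). [folklore] -/
theorem pt_add_unitVec {M : Fin d → ℕ} (hNM : ∀ ν, N ν = n * M ν) (hn : 0 < n) (x : Tor N) (ν : Fin d) :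
    pt n (x + unitVec N ν) = pt n x + (n : ℝ)⁻¹ • ev ν - (if (x ν).val + 1 = N ν then (M ν : ℝ) • ev ν else 0) := by
  have hn' : (n : ℝ) ≠ 0 := by exact_mod_cast hn.ne'
  have hv : ((x + unitVec N ν) ν).val = if (x ν).val + 1 = N ν then 0 else (x ν).val + 1 := by
    rw [add_unitVec_self, val_add_one']
  split_ifs with h
  · rw [if_pos h] at hv
    have e : ((x ν).val : ℝ) + 1 = (n : ℝ) * (M ν : ℝ) := by exact_mod_cast h.trans (hNM ν)
    funext ι
    by_cases hι : ι = ν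
    · subst hι
      rw [Pi.sub_apply, Pi.add_apply, pt_apply, pt_apply, hv, Pi.smul_apply, Pi.smul_apply, smul_eq_mul, smul_eq_mul, ev_apply_self,
        mul_one, mul_one, Nat.cast_zero, zero_div]
      field_simp
      linarith
    · rw [Pi.sub_apply, Pi.add_apply, pt_apply, pt_apply, add_unitVec_ne x hι, Pi.smul_apply, Pi.smul_apply, smul_eq_mul, smul_eq_mul,
        ev_apply_ne hι, mul_zero, mul_zero, add_zero, sub_zero]
  · rw [if_neg h] at hv
    funext ι
    by_cases hι : ι = ν
    · subst hι
      rw [Pi.sub_apply, Pi.add_apply, pt_apply, pt_apply, hv, Pi.smul_apply, smul_eq_mul, ev_apply_self, mul_one, Pi.zero_apply, sub_zero]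
      push_cast
      field_simp
    · rw [Pi.sub_apply, Pi.add_apply, pt_apply, pt_apply, add_unitVec_ne x hι, Pi.smul_apply, smul_eq_mul, ev_apply_ne hι, mul_zero,
        add_zero, Pi.zero_apply, sub_zero]

variable {A : (Fin d → ℝ) → Fin d → ℝ} {M : Fin d → ℕ}

omit hN in
/-- periodicity backwards: `A (p − M_ν·e_ν) = A p`. [folklore] -/
theorem periodic_sub (hper : ∀ p ν, A (p + (M ν : ℝ) • ev ν) = A p) (p : Fin d → ℝ) (ν : Fin d) :
    A (p - (M ν : ℝ) • ev ν) = A p := by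
  have h := hper (p - (M ν : ℝ) • ev ν) ν
  rw [sub_add_cancel] at h
  exact h.symm

/-- **ONE LATTICE STEP MOVES THE ARGUMENT OF `A` BY `n⁻¹·e_ν`** (the wrap-around absorbed by periodicity). [folklore] -/
theorem A_pt_add_unitVec (hNM : ∀ ν, N ν = n * M ν) (hn : 0 < n) (hper : ∀ p ν, A (p + (M ν : ℝ) • ev ν) = A p)
    (x : Tor N) (ν : Fin d) (v : Fin d → ℝ) :
    A (pt n (x + unitVec N ν) + v) = A (pt n x + (n : ℝ)⁻¹ • ev ν + v) := by
  rw [pt_add_unitVec n hNM hn x ν]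
  split_ifs
  · rw [show pt n x + (n : ℝ)⁻¹ • ev ν - (M ν : ℝ) • ev ν + v = (pt n x + (n : ℝ)⁻¹ • ev ν + v) - (M ν : ℝ) • ev ν by abel,
      periodic_sub hper]
  · rw [sub_zero]

/-- one lattice step BACKWARDS moves the argument of `A` by `−n⁻¹·e_ν`. [folklore] -/
theorem A_pt_sub_unitVec (hNM : ∀ ν, N ν = n * M ν) (hn : 0 < n) (hper : ∀ p ν, A (p + (M ν : ℝ) • ev ν) = A p)
    (x : Tor N) (ν : Fin d) (v : Fin d → ℝ) :
    A (pt n (x - unitVec N ν) + v) = A (pt n x - (n : ℝ)⁻¹ • ev ν + v) := by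
  have h := A_pt_add_unitVec n hNM hn hper (x - unitVec N ν) ν (-((n : ℝ)⁻¹ • ev ν) + v)
  rw [sub_add_cancel] at h
  have e1 : pt n (x - unitVec N ν) + (n : ℝ)⁻¹ • ev ν + (-((n : ℝ)⁻¹ • ev ν) + v) = pt n (x - unitVec N ν) + v := by abel
  have e2 : pt n x + (-((n : ℝ)⁻¹ • ev ν) + v) = pt n x - (n : ℝ)⁻¹ • ev ν + v := by abel
  rw [e1, e2] at h
  exact h.symm

variable (L : ℕ) [NeZero L]

/-- **THE SITES OF THE STRAIGHT COARSE BOND**: the `s`-th site on the coarse bond `(y, μ)` (spacing `n⁻¹`) read at the fine spacing `(nL)⁻¹`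
sits at `pt n y + (s∕(nL))·e_μ`. [folklore] -/
theorem pt_corner_add_tstep (hn : 0 < n) (y : Tor N) (μ : Fin d) {s : ℕ} (hs : s < L) :
    pt (n * L) (bpt L N y 0 + tstep (fine L N) μ s) = pt n y + ((s : ℝ) / ((n : ℝ) * L)) • ev μ := by
  have hn' : (n : ℝ) ≠ 0 := by exact_mod_cast hn.ne'
  have hL' : (L : ℝ) ≠ 0 := by exact_mod_cast NeZero.ne L
  funext ι
  rw [pt_apply, val_corner_add_tstep L N y μ ι hs, Pi.add_apply, Pi.smul_apply, pt_apply, smul_eq_mul]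
  by_cases hι : ι = μ
  · subst hι
    rw [if_pos rfl, ev_apply_self, mul_one]
    push_cast
    field_simp
  · rw [if_neg hι, ev_apply_ne hι, mul_zero, add_zero, add_zero]
    push_cast
    field_simp

omit hN [NeZero L] in
/-- reading through `sites` preserves the continuum point. [folklore] -/
theorem pt_sites (m : ℕ) (M : Fin d → ℕ) (x : Tor (fine (n * L) M)) : pt m (sites n L M x) = pt m x := by
  funext ν
  rw [pt_apply, pt_apply, val_sites]

end Coordinates

/-! ## §2 The Wilson-line phases and bond variables; unit modulus and size -/

section Phases

variable (n : ℕ) (A : (Fin d → ℝ) → Fin d → ℝ) {N : Fin d → ℕ}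

/-- **THE WILSON-LINE PHASE** of the bond `(x, μ)` at spacing `n⁻¹`: `∫₀^{n⁻¹} A (pt n x + s·e_μ) μ ds`. [folklore] -/
def wl (x : Tor N) (μ : Fin d) : ℝ := ∫ s in (0 : ℝ)..(n : ℝ)⁻¹, A (pt n x + s • ev μ) μ

/-- **THE WILSON-LINE BOND VARIABLE** `exp (i·wl)`. [folklore] -/
def wlR (x : Tor N) (μ : Fin d) : ℂ := Complex.exp (Complex.I * ((wl n A x μ : ℝ) : ℂ))

/-- unit modulus. [folklore] -/
theorem norm_wlR (x : Tor N) (μ : Fin d) : ‖wlR n A x μ‖ = 1 := by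
  rw [wlR, mul_comm]; exact Complex.norm_exp_ofReal_mul_I _

/-- `‖wlR − wlR'‖ ≤ |wl − wl'|` (any two bonds, spacings, connections): `|e^{ia} − e^{ib}| ≤ |a − b|`. [folklore] -/
theorem norm_wlR_sub_wlR_le (m : ℕ) (B : (Fin d → ℝ) → Fin d → ℝ) {N' : Fin d → ℕ} (x : Tor N) (μ : Fin d) (y : Tor N') (ν : Fin d) :
    ‖wlR n A x μ - wlR m B y ν‖ ≤ |wl n A x μ - wl m B y ν| := by
  unfold wlR
  have e : Complex.exp (Complex.I * (wl n A x μ : ℂ)) - Complex.exp (Complex.I * (wl m B y ν : ℂ))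
      = Complex.exp (Complex.I * (wl m B y ν : ℂ)) * (Complex.exp (Complex.I * ((wl n A x μ - wl m B y ν : ℝ) : ℂ)) - 1) := by
    rw [mul_sub, mul_one, ← Complex.exp_add]
    congr 1
    congr 1
    push_cast
    ring
  rw [e, norm_mul, mul_comm Complex.I (wl m B y ν : ℂ), Complex.norm_exp_ofReal_mul_I, one_mul]
  exact (Real.norm_exp_I_mul_ofReal_sub_one_le).trans (le_of_eq (Real.norm_eq_abs _))

/-- `‖wlR₁·wlR₂ − wlR₃·wlR₄‖ ≤ |wl₁ + wl₂ − (wl₃ + wl₄)|` (products of bond variables are exponentials of sums of phases). [folklore] -/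
theorem norm_wlR_mul_sub_mul_le (x₁ x₂ x₃ x₄ : Tor N) (μ₁ μ₂ μ₃ μ₄ : Fin d) :
    ‖wlR n A x₁ μ₁ * wlR n A x₂ μ₂ - wlR n A x₃ μ₃ * wlR n A x₄ μ₄‖ ≤ |wl n A x₁ μ₁ + wl n A x₂ μ₂ - (wl n A x₃ μ₃ + wl n A x₄ μ₄)| := by
  unfold wlR
  have e1 : Complex.exp (Complex.I * (wl n A x₁ μ₁ : ℂ)) * Complex.exp (Complex.I * (wl n A x₂ μ₂ : ℂ))
      = Complex.exp (Complex.I * ((wl n A x₁ μ₁ + wl n A x₂ μ₂ : ℝ) : ℂ)) := by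
    rw [← Complex.exp_add]; congr 1; push_cast; ring
  have e2 : Complex.exp (Complex.I * (wl n A x₃ μ₃ : ℂ)) * Complex.exp (Complex.I * (wl n A x₄ μ₄ : ℂ))
      = Complex.exp (Complex.I * ((wl n A x₃ μ₃ + wl n A x₄ μ₄ : ℝ) : ℂ)) := by
    rw [← Complex.exp_add]; congr 1; push_cast; ring
  have key : ∀ a b : ℝ, ‖Complex.exp (Complex.I * (a : ℂ)) - Complex.exp (Complex.I * (b : ℂ))‖ ≤ |a - b| := by
    intro a b
    have e : Complex.exp (Complex.I * (a : ℂ)) - Complex.exp (Complex.I * (b : ℂ))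
        = Complex.exp (Complex.I * (b : ℂ)) * (Complex.exp (Complex.I * ((a - b : ℝ) : ℂ)) - 1) := by
      rw [mul_sub, mul_one, ← Complex.exp_add]
      congr 1
      congr 1
      push_cast
      ring
    rw [e, norm_mul, mul_comm Complex.I (b : ℂ), Complex.norm_exp_ofReal_mul_I, one_mul]
    exact (Real.norm_exp_I_mul_ofReal_sub_one_le).trans (le_of_eq (Real.norm_eq_abs _))
  rw [e1, e2]
  exact key _ _

variable {A} {α₀ : ℝ}

/-- **SIZE**: `|wl n A x μ| ≤ α₀∕n` for `|A| ≤ α₀`. [folklore] -/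
theorem abs_wl_le (hbd : ∀ p μ, |A p μ| ≤ α₀) (hn : 0 < n) (x : Tor N) (μ : Fin d) : |wl n A x μ| ≤ α₀ / n := by
  have h := intervalIntegral.norm_integral_le_of_norm_le_const (a := (0 : ℝ)) (b := (n : ℝ)⁻¹) (C := α₀)
    (f := fun s => A (pt n x + s • ev μ) μ) (fun s _ => by rw [Real.norm_eq_abs]; exact hbd _ _)
  have hn' : (0 : ℝ) < n := by exact_mod_cast hn
  rw [Real.norm_eq_abs, sub_zero, abs_of_pos (inv_pos.mpr hn')] at h
  simpa [wl, div_eq_mul_inv] using h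

/-- **THE SIZE LINE OF THE REGULAR PRESENTATION**: `‖wlR n A x μ − 1‖ ≤ α₀∕n`. [folklore] -/
theorem norm_wlR_sub_one_le (hbd : ∀ p μ, |A p μ| ≤ α₀) (hn : 0 < n) (x : Tor N) (μ : Fin d) : ‖wlR n A x μ - 1‖ ≤ α₀ / n := by
  refine (Real.norm_exp_I_mul_ofReal_sub_one_le).trans ?_
  rw [Real.norm_eq_abs]
  exact abs_wl_le n hbd hn x μ

end Phases

/-! ## §3 Lipschitz across one lattice spacing: own-direction Lipschitz and the plaquette commutator -/

section Lipschitz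

variable (n : ℕ) {A : (Fin d → ℝ) → Fin d → ℝ} {N : Fin d → ℕ} [hN : ∀ ν, NeZero (N ν)] {M : Fin d → ℕ} {lip : ℝ}

omit hN in
/-- continuity of the integrand along a coordinate line. [folklore] -/
theorem continuous_line (hA : Continuous A) (p v : Fin d → ℝ) (μ : Fin d) : Continuous fun s : ℝ => A (p + s • v) μ :=
  (continuous_apply μ).comp (hA.comp (continuous_const.add (continuous_id.smul continuous_const)))

omit hN in
/-- **SHIFTING THE BASE POINT BY `h·e_ν` CHANGES THE WILSON-LINE INTEGRAL BY `≤ lip·|h|∕n`.** [folklore] -/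
theorem abs_lineIntegral_shift_sub_le (hA : Continuous A) (hlip : ∀ p ν (h : ℝ) μ, |A (p + h • ev ν) μ - A p μ| ≤ lip * |h|)
    (hn : 0 < n) (p : Fin d → ℝ) (ν μ : Fin d) (h : ℝ) :
    |(∫ s in (0 : ℝ)..(n : ℝ)⁻¹, A (p + h • ev ν + s • ev μ) μ) - ∫ s in (0 : ℝ)..(n : ℝ)⁻¹, A (p + s • ev μ) μ| ≤ lip * |h| / n := by
  rw [← intervalIntegral.integral_sub ((continuous_line hA _ _ μ).intervalIntegrable _ _) ((continuous_line hA _ _ μ).intervalIntegrable _ _)]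
  have hb := intervalIntegral.norm_integral_le_of_norm_le_const (a := (0 : ℝ)) (b := (n : ℝ)⁻¹) (C := lip * |h|)
    (f := fun s => A (p + h • ev ν + s • ev μ) μ - A (p + s • ev μ) μ) (fun s _ => by
      rw [Real.norm_eq_abs, show p + h • ev ν + s • ev μ = (p + s • ev μ) + h • ev ν by abel]
      exact hlip _ _ _ _)
  have hn' : (0 : ℝ) < n := by exact_mod_cast hn
  rw [Real.norm_eq_abs, sub_zero, abs_of_pos (inv_pos.mpr hn')] at hb
  simpa [div_eq_mul_inv] using hb

/-- **MOVING THE BOND ONE LATTICE STEP IN ANY DIRECTION CHANGES ITS WILSON-LINE PHASE BY `≤ lip∕n²`.** [folklore] -/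
theorem abs_wl_add_unitVec_sub_le (hNM : ∀ ν, N ν = n * M ν) (hn : 0 < n) (hA : Continuous A)
    (hlip : ∀ p ν (h : ℝ) μ, |A (p + h • ev ν) μ - A p μ| ≤ lip * |h|) (hper : ∀ p ν, A (p + (M ν : ℝ) • ev ν) = A p)
    (x : Tor N) (ν μ : Fin d) : |wl n A (x + unitVec N ν) μ - wl n A x μ| ≤ lip / (n : ℝ) ^ 2 := by
  have hn' : (0 : ℝ) < n := by exact_mod_cast hn
  have e : wl n A (x + unitVec N ν) μ = ∫ s in (0 : ℝ)..(n : ℝ)⁻¹, A (pt n x + (n : ℝ)⁻¹ • ev ν + s • ev μ) μ := by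
    unfold wl
    refine intervalIntegral.integral_congr fun s _ => ?_
    show A (pt n (x + unitVec N ν) + s • ev μ) μ = A (pt n x + (n : ℝ)⁻¹ • ev ν + s • ev μ) μ
    rw [A_pt_add_unitVec n hNM hn hper]
  rw [e, wl]
  refine (abs_lineIntegral_shift_sub_le n hA hlip hn (pt n x) ν μ _).trans (le_of_eq ?_)
  rw [abs_of_pos (inv_pos.mpr hn'), ← div_eq_mul_inv, div_div, pow_two]

/-- **OWN-DIRECTION LIPSCHITZ (the regular presentation's second line)**: `‖wlR x μ − wlR (x − e_μ) μ‖ ≤ lip∕n²`. [folklore] -/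
theorem norm_wlR_sub_wlR_back_le (hNM : ∀ ν, N ν = n * M ν) (hn : 0 < n) (hA : Continuous A)
    (hlip : ∀ p ν (h : ℝ) μ, |A (p + h • ev ν) μ - A p μ| ≤ lip * |h|) (hper : ∀ p ν, A (p + (M ν : ℝ) • ev ν) = A p)
    (x : Tor N) (μ : Fin d) : ‖wlR n A x μ - wlR n A (x - unitVec N μ) μ‖ ≤ lip / (n : ℝ) ^ 2 := by
  refine (norm_wlR_sub_wlR_le n A n A x μ _ μ).trans ?_
  have h := abs_wl_add_unitVec_sub_le n hNM hn hA hlip hper (x - unitVec N μ) μ μ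
  rwa [sub_add_cancel] at h

/-- **THE PLAQUETTE COMMUTATOR OF THE END** (`VariationalColourTaxiTowerEnd…`'s `hb` shape, scalar): `‖R(x,κ)R(x+e_κ,ι) − R(x,ι)R(x+e_ι,κ)‖ ≤ 2lip∕n²` —
Lipschitz of `A` across ONE lattice spacing, no Stokes. [folklore] -/
theorem norm_wlR_comm_le (hNM : ∀ ν, N ν = n * M ν) (hn : 0 < n) (hA : Continuous A)
    (hlip : ∀ p ν (h : ℝ) μ, |A (p + h • ev ν) μ - A p μ| ≤ lip * |h|) (hper : ∀ p ν, A (p + (M ν : ℝ) • ev ν) = A p)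
    (x : Tor N) (κ ι : Fin d) :
    ‖wlR n A x κ * wlR n A (x + unitVec N κ) ι - wlR n A x ι * wlR n A (x + unitVec N ι) κ‖ ≤ 2 * lip / (n : ℝ) ^ 2 := by
  refine (norm_wlR_mul_sub_mul_le n A _ _ _ _ _ _ _ _).trans ?_
  have h1 := abs_wl_add_unitVec_sub_le n hNM hn hA hlip hper x κ ι
  have h2 := abs_wl_add_unitVec_sub_le n hNM hn hA hlip hper x ι κ
  rw [show wl n A x κ + wl n A (x + unitVec N κ) ι - (wl n A x ι + wl n A (x + unitVec N ι) κ)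
      = (wl n A (x + unitVec N κ) ι - wl n A x ι) - (wl n A (x + unitVec N ι) κ - wl n A x κ) by ring]
  refine (abs_sub _ _).trans ?_
  rw [two_mul, add_div]
  exact add_le_add h1 h2

end Lipschitz

/-! ## §4 Exact coherence: the straight product of the sub-bond Wilson lines is the Wilson line of the coarse bond -/

section Coherence

variable (n L : ℕ) [NeZero n] [NeZero L] {A : (Fin d → ℝ) → Fin d → ℝ} (M : Fin d → ℕ) [hM : ∀ ν, NeZero (M ν)]

/-- the sub-bond phases add up to the coarse phase: `Σ_{s<L} wl (nL) (corner + s·e_μ) μ = wl n y μ`. [folklore] -/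
theorem sum_wl_subbonds (hA : Continuous A) (y : Tor (fine n M)) (μ : Fin d) :
    ∑ s ∈ Finset.range L, wl (n * L) A (bpt L (fine n M) y 0 + tstep (fine L (fine n M)) μ s) μ = wl n A y μ := by
  have hn : 0 < n := Nat.pos_of_ne_zero (NeZero.ne n)
  have hn' : (n : ℝ) ≠ 0 := by exact_mod_cast hn.ne'
  have hL' : (L : ℝ) ≠ 0 := by exact_mod_cast NeZero.ne L
  -- each sub-bond integral is the coarse integrand over the window `[s∕(nL), (s+1)∕(nL)]`
  have hterm : ∀ s ∈ Finset.range L, wl (n * L) A (bpt L (fine n M) y 0 + tstep (fine L (fine n M)) μ s) μ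
      = ∫ u in ((s : ℝ) / ((n : ℝ) * L))..(((s + 1 : ℕ) : ℝ) / ((n : ℝ) * L)), A (pt n y + u • ev μ) μ := by
    intro s hs
    have hs' := Finset.mem_range.mp hs
    unfold wl
    rw [pt_corner_add_tstep n L hn y μ hs']
    have e : ∀ u : ℝ, pt n y + ((s : ℝ) / ((n : ℝ) * L)) • ev μ + u • ev μ = pt n y + (u + (s : ℝ) / ((n : ℝ) * L)) • ev μ := by
      intro u; rw [add_smul]; abel
    simp_rw [e]
    have hsh := intervalIntegral.integral_comp_add_right (a := (0 : ℝ)) (b := (((n * L : ℕ)) : ℝ)⁻¹)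
      (fun u => A (pt n y + u • ev μ) μ) ((s : ℝ) / ((n : ℝ) * L))
    have ha : (0 : ℝ) + (s : ℝ) / ((n : ℝ) * L) = (s : ℝ) / ((n : ℝ) * L) := zero_add _
    have hb : (((n * L : ℕ)) : ℝ)⁻¹ + (s : ℝ) / ((n : ℝ) * L) = ((s + 1 : ℕ) : ℝ) / ((n : ℝ) * L) := by
      push_cast
      field_simp
      ring
    rw [ha, hb] at hsh
    exact hsh
  rw [Finset.sum_congr rfl hterm, intervalIntegral.sum_integral_adjacent_intervals (a := fun k : ℕ => (k : ℝ) / ((n : ℝ) * L))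
    (fun k _ => (continuous_line hA _ _ μ).intervalIntegrable _ _)]
  have hlim : ((L : ℕ) : ℝ) / ((n : ℝ) * L) = (n : ℝ)⁻¹ := by field_simp
  simp only [Nat.cast_zero, zero_div, hlim]
  rfl

/-- **EXACT COHERENCE**: the straight `L`-bond coarsening of the Wilson lines at spacing `(nL)⁻¹` IS the Wilson lines at spacing `n⁻¹`. [folklore] -/
theorem coarseT_wlR (hA : Continuous A) : coarseT L (fine n M) (wlR (n * L) A) = wlR n A (N := fine n M) := by
  funext y μ
  rw [coarseT, piT_eq_prod]
  unfold wlR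
  rw [← Complex.exp_sum, ← Finset.mul_sum]
  congr 2
  exact_mod_cast sum_wl_subbonds n L M hA y μ

omit [NeZero n] [NeZero L] hM in
/-- **READING THROUGH `sites` PRESERVES THE WILSON LINES** (they are functions of the coordinates). [folklore] -/
theorem Rtr_wlR (m : ℕ) (A : (Fin d → ℝ) → Fin d → ℝ) : Rtr n L M (wlR m A) = wlR m A (N := fine (n * L) M) := by
  funext x μ
  simp only [Rtr, wlR, wl, pt_sites]

end Coherence

end Summit.QuantumFields.BalabanUV.T4Continuum.WilsonLineTower

end
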